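/-
Copyright (c) 2026. All rights reserved.
Released under Apache 2.0 license as described in the file LICENSE.
Authors: abc-iut cell, statement-typer seat abc-iut-L4-t3 (wave 1).
-/
import Literature.AnabelianGeometry.AbsoluteAnabelian.LocalVolumesNonarchimedean
import Literature.AnabelianGeometry.AbsoluteAnabelian.LocalVolumesArchimedean
import Literature.AnabelianGeometry.AbsoluteAnabelian.LogShells
import Mathlib.GroupTheory.Torsion
import HarnessLib

/-!
# [AbsTopIII] Corollary 5.10 (i), (ii), (iv)(d) and Definition 5.9 (ii): log-volumes of log-shells

S. Mochizuki, *Topics in absolute anabelian geometry III: global reconstruction algorithms*,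
J. Math. Sci. Univ. Tokyo 22 (2015) 939–1156 [MochizukiAbsTopIII2015]; locators `p.N` = pages of the
author's manuscript (`paper:url-5493eb38cbb7`; journal pagination not held), read on the page: Def 5.9 (ii)
pp. 143–144, Cor 5.10 (i), (ii) p. 147, (iv)(d) p. 148, Rmk 5.10.1 p. 149, Rmk 5.10.2 pp. 149–154 (record).

The NUMERICAL content of the "Fundamental Properties of Log-shells" (Cor 5.10), in the concrete models of
`LocalVolumesNonarchimedean.lean` (nonarchimedean `k`: `μ_k`, `μ_k^log` on `M(k)`), `LocalVolumesArchimedean.lean`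
(`k ≅ ℂ`: radial/angular volumes) and `LogShells.lean` (the log-shells `ℐ = (p*)⁻¹·log(𝒪_k^×)`, `ℐ = closedBall 0 π`):

* Def 5.9 (ii): "the log-volumes of Prop 5.7 (i), (ii) determine maps `μ^log_v : M(M_v^{Π_v}) → R_v`,
  `μ̆^log_v : M̆(M_v) → R_v`" — here: the local log-volume data of a family of local fields (`LocalLogVolumeData`);
* Cor 5.10 (i) (Finite Log-volume): the log-shell is of finite (positive) log-volume — PROVED in the archimedean
  model (`archLogShell_mem_radialAdmissible`, `radialVolume_archLogShell : μ(ℐ) = π`, `radialLogVolume_archLogShell`),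
  and stated for the nonarchimedean model as the predicate `LogShellFiniteVolume L` (it needs `log(𝒪^×)` to be
  compact open, i.e. continuity/homomorphy of `log_k`, which the hypothesis structure `PadicLogOnUnits` does not
  carry — TODO-merge abc-iut-S1);
* Cor 5.10 (ii) (Log-Frobenius Compatibility of Log-volumes): "the log-volume computed at `⋎ ∈ L` is compatible
  [cf. Prop 5.7 (i)(c), (ii)(c)], relative to the log-homotopy, with the log-volume (resp. angular log-volume)
  computed at `⋎ + 1`" — the conjunction, over the places, of `LogVolumeCompatible` / `ExpLogVolumeCompatible`;
* Cor 5.10 (iv)(d) (Mono-analytic Log-shells): the mono-analytically reconstructed log-volume of `ℐ(G)` (Prop 5.8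
  (iii): `MLFType.logShellLogVolume`) agrees with the field-theoretic `μ_k^log(ℐ_k)` — the COMPARISON named fact
  `MonoAnalyticLogShellVolume` (dischargeable once the `p`-adic logarithm of abc-iut-S1 instantiates
  `PadicLogOnUnits`), and its archimedean counterpart PROVED (`radialLogVolume_archLogShell` =
  `ComplexLogShell.logShellRadialLogVolume`).

Rmk 5.10.1 (`η⊢` composed with the telecore arrow), 5.10.2 ("the significance of the theory of log-shells …
rigid integral structures immune to the log-wall and to mono-analyticization"; ×8 cited by IUT), 5.10.3 (analogy
with `p`-adic Teichmüller theory), 5.10.4 (analogy with Frobenius liftings) are expository RECORD NODES, cited here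
only. Refereed pre-IUT material; nothing here bears on [IUTchIII] Cor. 3.12; typed ≠ discharged.
-/

set_option autoImplicit false

noncomputable section

open MeasureTheory Set Metric
open scoped Pointwise Real

namespace Literature.AnabelianGeometry.AbsoluteAnabelian

/-! ## Def 5.9 (ii): local log-volume data -/

/-- **Def 5.9 (ii)**: the log-volumes of Prop 5.7 determine, for the local data `M_v` of a global/panalocal `T`-pair
(`T ∈ {TF, TM}`), maps `μ^log_v : M(M_v^{Π_v}) → R_v` (`v ∈ V`) and `μ̆^log_v : M̆(M_v) → R_v` (`v ∈ V^arc`) "by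
intersecting with `M_T(Π,v)^{Π_v} ⊆ k_NF(Π,v)^{Π_v}` the corresponding collection of subsets" — recorded as the datum,
for a family of completions indexed by `V = V^non ⊔ V^arc`, of the real-valued log-volumes (read in `R_v ≅ ℝ`).
[cite: MochizukiAbsTopIII2015, Def 5.9 (ii) pp. 143–144] -/
structure LocalLogVolumeData (Vnon Varc : Type) : Type 1 where
  /-- the invariant part `M_v^{Π_v} ⊆ k_v` at nonarchimedean `v`, as a set-system carrier -/
  carrierNon : Vnon → Type
  /-- `M(M_v^{Π_v})` -/
  admissibleNon : ∀ v, Set (Set (carrierNon v))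
  /-- `μ^log_v` -/
  logVolNon : ∀ v, Set (carrierNon v) → ℝ
  /-- the carrier at archimedean `v` -/
  carrierArc : Varc → Type
  /-- `M(M_v)` -/
  admissibleArc : ∀ v, Set (Set (carrierArc v))
  /-- `M̆(M_v)` -/
  angAdmissibleArc : ∀ v, Set (Set (carrierArc v))
  /-- radial `μ^log_v` -/
  logVolArc : ∀ v, Set (carrierArc v) → ℝ
  /-- angular `μ̆^log_v` -/
  angLogVolArc : ∀ v, Set (carrierArc v) → ℝ

/-- the local log-volume data of the MODEL family: nonarchimedean local fields `K v` (with `μ^log_{K v}` on `M(K v)`)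
and `ℂ` at every archimedean index (radial/angular log-volumes on `M(ℂ)`, `M̆(ℂ)`).
[cite: MochizukiAbsTopIII2015, Def 5.9 (ii) pp. 143–144] -/
def LocalLogVolumeData.model {Vnon Varc : Type} (K : Vnon → Type) [∀ v, NontriviallyNormedField (K v)]
    [∀ v, IsUltrametricDist (K v)] [∀ v, ProperSpace (K v)] [∀ v, MeasurableSpace (K v)] [∀ v, BorelSpace (K v)] :
    LocalLogVolumeData Vnon Varc where
  carrierNon := K
  admissibleNon v := compactOpens (K v)
  logVolNon v := localLogVolume (K v)
  carrierArc _ := ℂ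
  admissibleArc _ := ComplexVolume.radialAdmissible
  angAdmissibleArc _ := ComplexVolume.angularAdmissible
  logVolArc _ := ComplexVolume.radialLogVolume
  angLogVolArc _ := ComplexVolume.angularLogVolume

/-! ## Cor 5.10 (i): finite log-volume of the log-shell -/

section Nonarch

variable {K : Type*} [NontriviallyNormedField K] [IsUltrametricDist K] [ProperSpace K]
  [MeasurableSpace K] [BorelSpace K]

/-- **Cor 5.10 (i), nonarchimedean** as a predicate on the `p`-adic-logarithm structure: the log-shell
`ℐ = (p*)⁻¹·log(𝒪_k^×) ⊆ k = S^Gal` "is of finite log-volume", i.e. lies in `M(k)` (compact open, nonempty), so that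
`μ_k^log(ℐ)` is defined; it holds for the actual `log_k` (a continuous homomorphism on the compact group `𝒪_k^×` with
open image), which `PadicLogOnUnits` does not record (TODO-merge abc-iut-S1).
[cite: MochizukiAbsTopIII2015, Cor 5.10 (i) p. 147] -/
def LogShellFiniteVolume (L : PadicLogOnUnits K) : Prop := logShell L ∈ compactOpens K

/-- under `LogShellFiniteVolume`, the log-shell has positive finite volume and contains `𝒪_k` (so `μ_k^log(ℐ) ≥ 0`).
[cite: MochizukiAbsTopIII2015, Cor 5.10 (i) p. 147] -/
theorem localLogVolume_logShell_nonneg (L : PadicLogOnUnits K) (h : LogShellFiniteVolume L) :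
    0 ≤ localLogVolume K (logShell L) := by
  apply Real.log_nonneg
  have h1 : localVolume K (closedBall (0 : K) 1) ≤ localVolume K (logShell L) := by
    unfold localVolume
    exact ENNReal.toReal_mono (localHaar_lt_top_of_mem h).ne (measure_mono (closedBall_subset_logShell L))
  rwa [localVolume_closedBall_one] at h1

/-- **Cor 5.10 (iv)(d), nonarchimedean comparison** (named fact, the content behind "these ⊢-log-shells and
log-volumes depend only on the mono-analyticized data"): for an MLF `k` of type `t = (p, f, e, m)` — residue field of
cardinality `p^f = [𝒪 : ϖ𝒪]`, `p*` as in Def 5.4 (iii) — the field-theoretic log-volume of the log-shell equals the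
mono-analytically reconstructed value of Prop 5.8 (iii):
`μ_k^log(ℐ_k) = {-1 - m/f + e·log(p*)/log(p)}·(f·log p) = t.logShellLogVolume`. Dischargeable once `log_k` is
available (index computation `[log(𝒪^×) : p*𝒪] · μ(p*𝒪)`); TODO-merge abc-iut-S1. [cite: MochizukiAbsTopIII2015, Cor 5.10 (iv)(d) p. 148] -/
def MonoAnalyticLogShellVolume (L : PadicLogOnUnits K) (t : MLFType) : Prop :=
  ∀ ϖ : Kˣ, ‖(ϖ : K)‖ < 1 → (∀ x : K, ‖x‖ < 1 → ‖x‖ ≤ ‖(ϖ : K)‖) →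
    Literature.NumberTheory.GaloisRepresentations.Ultrametric.resIndex ϖ = t.p ^ t.f →
    ‖L.pstar‖ = ‖(ϖ : K)‖ ^ (t.e * (if t.p = 2 then 2 else 1)) →
    LogShellFiniteVolume L → localLogVolume K (logShell L) = t.logShellLogVolume

end Nonarch

section Arch

open ComplexVolume ComplexLogShell

/-- the archimedean log-shell `ℐ = closedBall 0 π` is `π · 𝒪_k`. [cite: MochizukiAbsTopIII2015, Def 5.4 (v) p. 127] -/
theorem archLogShell_eq_smul : ComplexLogShell.logShell = (π : ℂ) • closedBall (0 : ℂ) 1 := by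
  rw [logShell_eq_closedBall, smul_closedBall' (by exact_mod_cast Real.pi_pos.ne') , smul_zero, Complex.norm_real,
    Real.norm_eq_abs, abs_of_pos Real.pi_pos, mul_one]

/-- **Cor 5.10 (i), archimedean**: the log-shell `ℐ = closedBall 0 π ⊆ k~` lies in `M(k)` …
[cite: MochizukiAbsTopIII2015, Cor 5.10 (i) p. 147] -/
theorem archLogShell_mem_radialAdmissible : ComplexLogShell.logShell ∈ radialAdmissible := by
  rw [logShell_eq_closedBall]
  refine ⟨⟨0, by simp [Real.pi_pos.le]⟩, isCompact_closedBall _ _, ?_⟩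
  have h : ((‖·‖) '' closedBall (0 : ℂ) π : Set ℝ) = Icc 0 π := by
    ext r
    simp only [mem_image, mem_closedBall, dist_zero_right, mem_Icc]
    constructor
    · rintro ⟨a, ha, rfl⟩; exact ⟨norm_nonneg a, ha⟩
    · rintro ⟨h0, h1⟩
      exact ⟨(r : ℂ), by simpa [abs_of_nonneg h0] using h1, by simp [abs_of_nonneg h0]⟩
  rw [h, interior_Icc, closure_Ioo Real.pi_pos.ne]

/-- … and has radial volume `μ(ℐ) = π` (finite). [cite: MochizukiAbsTopIII2015, Cor 5.10 (i) p. 147] -/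
theorem radialVolume_archLogShell : radialVolume ComplexLogShell.logShell = π := by
  rw [archLogShell_eq_smul, radialVolume_smul, radialVolume_closedBall_one, mul_one, Complex.norm_real,
    Real.norm_eq_abs, abs_of_pos Real.pi_pos]

/-- **Cor 5.10 (iv)(d), archimedean comparison, PROVED**: the radial log-volume of the archimedean log-shell is
`log π`, the mono-analytically reconstructed value of Prop 5.8 (vi) (`ComplexLogShell.logShellRadialLogVolume`).
[cite: MochizukiAbsTopIII2015, Cor 5.10 (iv)(d) p. 148] -/
theorem radialLogVolume_archLogShell :
    radialLogVolume ComplexLogShell.logShell = ComplexLogShell.logShellRadialLogVolume := by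
  rw [radialLogVolume, radialVolume_archLogShell]; rfl

/-- `𝒪^×_{k~} =` the unit circle has angular volume `2π`, angular log-volume `log 2π`
(`ComplexLogShell.unitsAngularLogVolume`). [cite: MochizukiAbsTopIII2015, Cor 5.10 (iv)(d) p. 148] -/
theorem angularLogVolume_archUnits :
    angularLogVolume ComplexLogShell.units = ComplexLogShell.unitsAngularLogVolume := by
  rw [angularLogVolume, units_eq_sphere, angularVolume_sphere_one]; rfl

end Arch

/-! ## Cor 5.10 (ii): log-Frobenius compatibility of log-volumes -/

/-- **Cor 5.10 (ii)** (Log-Frobenius Compatibility of Log-volumes): for every place, "the log-volume (resp. radial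
log-volume) computed at `⋎ ∈ L` is compatible [cf. Prop 5.7 (i)(c), (ii)(c)], relative to the relevant log-homotopy,
with the log-volume (resp. angular log-volume) computed at `⋎ + 1 ∈ L`" — as the predicate on a family of local
logarithms: `LogVolumeCompatible (log_v)` at every nonarchimedean `v` and `ExpLogVolumeCompatible` (the exponential
of `ℂ`) at the archimedean ones. [cite: MochizukiAbsTopIII2015, Cor 5.10 (ii) p. 147] -/
def LogVolumesLogCompatible {Vnon : Type} (K : Vnon → Type) [∀ v, NontriviallyNormedField (K v)]
    [∀ v, IsUltrametricDist (K v)] [∀ v, ProperSpace (K v)] [∀ v, MeasurableSpace (K v)] [∀ v, BorelSpace (K v)]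
    (log : ∀ v, K v → K v) (hasArc : Prop) : Prop :=
  (∀ v, LogVolumeCompatible (log v)) ∧ (hasArc → ComplexVolume.ExpLogVolumeCompatible)


section NonarchOfType

variable {K : Type*} [NontriviallyNormedField K] [IsUltrametricDist K] [ProperSpace K]
  [MeasurableSpace K] [BorelSpace K]

/-- **F18 repair (referee PASS-F3; successor of `MonoAnalyticLogShellVolume`, append-only).** Print defines the
fourth entry of the type `t = (p, f, e, m)` of an MLF `k` by "`p^m`, the order of the subgroup of `p`-power roots of
unity of `k^×`" ([AbsTopIII] Prop 5.8 (i)/(iii) p. 139), i.e. `m = v_p(#μ(k))` (`μ(k) = (k^×)_tors`, finite for an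
MLF).  `MonoAnalyticLogShellVolume L t` binds `t.p`, `t.f`, `t.e` to `k` through its hypotheses but NOT `t.m`, so
as typed it asserts the volume formula for every `m` (false at the standard model unless `t.m = m_k`:
abc-iut-L6-d2's `monoAnalyticLogShellVolume_ofUnitLog_iff`).  This is the binding clause, in the tree's vocabulary
(`CommGroup.torsion kˣ`; for `k/ℚ_p` it reads `t.m = torsionPExp p k` of `Literature.IUT.LogVolume` by `rfl`).
[cite: MochizukiAbsTopIII2015, Prop 5.8 (iii) p. 139] -/
def MLFType.IsTorsionExpOf (t : MLFType) (K : Type*) [Field K] : Prop :=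
  t.m = padicValNat t.p (Nat.card (CommGroup.torsion Kˣ))

/-- **Cor 5.10 (iv)(d), nonarchimedean comparison — REPAIRED named fact (F18)**: for an MLF `k` of type
`t = (p, f, e, m)` with ALL FOUR entries bound to `k` (`m` via `MLFType.IsTorsionExpOf`), the field-theoretic
log-volume of the log-shell equals the mono-analytically reconstructed value of Prop 5.8 (iii),
`μ_k^log(ℐ_k) = {-1 - m/f + e·log(p*)/log(p)}·(f·log p)`.  Consumers should use THIS decl; the unbound
`MonoAnalyticLogShellVolume` is kept only for the importers already landed. [cite: MochizukiAbsTopIII2015, Cor 5.10 (iv)(d) p. 148] -/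
def MonoAnalyticLogShellVolumeOfType (L : PadicLogOnUnits K) (t : MLFType) : Prop :=
  t.IsTorsionExpOf K → MonoAnalyticLogShellVolume L t

end NonarchOfType

end Literature.AnabelianGeometry.AbsoluteAnabelian

end
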